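import Summits.CriticalPhenomena.PercolationContinuityZ3.Theorems.PercNearOneGluingNoHeavyLowerTailSahiThreeCopyTwoPointCertsK5Table

/-!
# Sahi's three-function conjecture — `k = 5` certificate checks, entries 2040–2269

COMPUTATIONAL (`native_decide`, integer arithmetic): the flow-form / face-form certificates of `certTable5` (`…TwoPointCertsK5Table`,
data `…TwoPointCertsK5Data*`) pass `checkEntry5` for the entries 2040 ≤ j < 2270 (chunks of 60).  Seat `prim-sahi-p1`, generation 61;
`--supports stmt-CriticalPhenomena-4575`. [this work]
-/

namespace Summit.CriticalPhenomena.PercolationContinuityZ3.Theorems.SahiThreeCopy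

/-- ★★ The certificates of `certTable5` pass the exact check — entries 2040–2099 (by evaluation). [this work] -/
theorem checkChunk5_2040 : checkChunk5 certTable5 upList5 (upSetsC 4) arrTab5 2040 60 = true := by
  native_decide

/-- ★★ The certificates of `certTable5` pass the exact check — entries 2100–2159 (by evaluation). [this work] -/
theorem checkChunk5_2100 : checkChunk5 certTable5 upList5 (upSetsC 4) arrTab5 2100 60 = true := by
  native_decide

/-- ★★ The certificates of `certTable5` pass the exact check — entries 2160–2219 (by evaluation). [this work] -/
theorem checkChunk5_2160 : checkChunk5 certTable5 upList5 (upSetsC 4) arrTab5 2160 60 = true := by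
  native_decide

/-- ★★ The certificates of `certTable5` pass the exact check — entries 2220–2225 (by evaluation). [this work] -/
theorem checkChunk5_2220 : checkChunk5 certTable5 upList5 (upSetsC 4) arrTab5 2220 6 = true := by
  native_decide

/-- ★★ The certificates of `certTable5` pass the exact check — entries 2227–2254 (by evaluation). [this work] -/
theorem checkChunk5_2227 : checkChunk5 certTable5 upList5 (upSetsC 4) arrTab5 2227 28 = true := by
  native_decide

/-- ★★ The certificates of `certTable5` pass the exact check — entries 2257–2264 (by evaluation). [this work] -/
theorem checkChunk5_2257 : checkChunk5 certTable5 upList5 (upSetsC 4) arrTab5 2257 8 = true := by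
  native_decide

/-- ★★ The certificates of `certTable5` pass the exact check — entries 2266–2269 (by evaluation). [this work] -/
theorem checkChunk5_2266 : checkChunk5 certTable5 upList5 (upSetsC 4) arrTab5 2266 4 = true := by
  native_decide


end Summit.CriticalPhenomena.PercolationContinuityZ3.Theorems.SahiThreeCopy
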